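import Literature.MathematicalPhysics.QuantumFieldTheory.Balaban1983to89.Node00.OpsYRecordV11Thresh
import Literature.MathematicalPhysics.QuantumFieldTheory.Balaban1983to89.B9Eq3115KnitLetterYRealReg335

/-!
# `Balaban1983to89.Node00.OpsYDelta2FormQ` — T. Bałaban, *Propagators for lattice gauge theories in a background field*, Commun. Math. Phys. **99**
# (1985) 389–434 [Balaban1985BackgroundPropagators], (3.134) p. 422 with (3.126) p. 420 and (3.115) p. 418: THE RESIDUAL LETTER `Δ⁽²⁾(U)` OVER A
# GENERIC `H`, OVER A GENERIC AVERAGING PAIR `(𝔮, 𝔮⋆)`, AND ★★★ AT PRINT's KNIT PAIR OF RECORD — `delta2OfHY`, `delta2OfQY`, ★★ `resYOfC2Q`,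
# ★★★ `resYOfRecordPK` (the knit residual of record), its (3.134) AT THE v11 KNIT RECORD's OWN `H`, and its Hermitian symmetry ON (3.35)

statement-level skeleton of published theorems with citation tags; proofs where landed; nothing here is a claim about the Yang–Mills mass gap

THE POINT (W5 of the seat's hand-off; dag-n06-l's `DELTA2-LETTERS-MEMO` «Δ2 stays free for def-Y»; the CASCADE-K lane, dag-lead WORDS 427).  The v11 knit
record `lettersYOfRecordV11K N θ M⋆ 𝔯` (`OpsYRecordV11`; ops of record `opsYNuStOfRecordV11KSE`, `OpsYRecordV11SH`) reads its seven Sect. D∕E composites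
through `H[𝔮](U) = HDQY …` over PRINT's knit pair `(qKnitOfRecord, qsKnitOfRecord)` ((3.115); [5] (15)), the knit transporter `parKnitY` and the
print-units propagator `G′_phys = GpPhysY (parKnitY)` (`covLettersY_v11_H`) — but its residual datum `𝔯` is FREE, and the only residual family of record
in the tree, `resYOfRecordP` (`OpsYC2OfRecord`), is (3.134) built from the STRAIGHT pair's `H` (`HDY` over `parSymY ∕ parBY`): at `𝔯 := resYOfRecordP`
the knit record's `G₁ = (G̃⁻¹ − Δ⁽²⁾)⁻¹` would mix two different `H`'s.  Print's (3.134) defines `Δ⁽²⁾` from THE SAME `H` as (3.126)∕(3.128).  THIS FILE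
closes Sect. D on itself at the knit pair — no new mathematics, every proof is the `OpsYDelta2Form` ∕ `OpsYDelta2FormP` ∕ `OpsYSectDReal` chain
re-instantiated:
* §1 the construction of `OpsYDelta2Form` §3∕§6 over a GENERIC `H : CfgY → ((IBondY → 𝔸) →ₗ (FBondY → 𝔸))` — `pairHJOfY`, ★ `delta2OfHY 𝔡 i H C`
  (`Δ⁽²⁾(U)A = 2ρ(A′ ↦ ⟨H(U)C⁽²⁾(U; A, A′), J(U)⟩_τ)`), the face `delta2OfY = delta2OfHY (HDY …)` (`rfl`), (3.134)∕(3.136) `trPairY_delta2OfHY`,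
  `_self`, `_trAdj`, `τ`-symmetry, ★ uniqueness `delta2OfHY_unique`, `delta2OfHY_one` (`Δ⁽²⁾(1) = 0`), `_flat`, reality `delta2OfHY_star[_of_unitary]`
  (real `C⁽²⁾(U)`, real `H(U)`, `J(U)⋆ = J(U)`) — each proof the §3∕§6 original with `HDY i parS parB Gp ↦ H`;
* §2 over a GENERIC PAIR: `delta2OfQY 𝔡 i 𝔮 𝔮s parS Gp C := delta2OfHY 𝔡 i (HDQY i 𝔮 𝔮s parS Gp) C`, its straight-pair face `delta2OfQY_QY` (`rfl` to
  `delta2OfY`), and the `Q`-GENERIC REALITY KIT at `M_N(ℂ)` (twins of `OpsYSectDReal` §Letters with the pair's reality DISPLAYED as `h𝔮 ∕ h𝔮s`):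
  `deltaPiAQY_isRealOpY`, `GDQY_isRealOpY`, `QGQQY_isRealOpY`, `QGQinvQY_isRealOpY`, ★ `HDQY_isRealOpY`;
* §3 AT THE RECORD: ★★ `resYOfC2Q N θ M⋆ 𝔮 𝔮s parS 𝔠 : ResY N θ M⋆` (member by member `delta2OfQY` at `M_N(ℂ)`, `G′_phys = GpPhysY (parS x.toKIdx)`,
  the form letter `𝔠`; `U = 1` clause PROVED), its straight-pair face ★ `resYOfC2Q_straight_Δ2 : (resYOfC2Q … (QY ∘ parBY) (QsY ∘ parBY) parSymY 𝔠 x).Δ2 =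
  (resYOfC2P … 𝔠 x).Δ2` (definitional, member by member: today's residual of record IS the straight-pair instance), (3.134) in matrix traces, trace symmetry, flatness, reality ∕
  `IsSymmTr 1` from the displayed reality of `𝔠` and of `H[𝔮](U)`; then the KNIT pins ★★ `resYOfC2PK 𝔠 := resYOfC2Q … qKnitOfRecord qsKnitOfRecord
  parKnitY 𝔠` and ★★★ `resYOfRecordPK := resYOfC2PK (c2YOfRecord …)` — THE KNIT RESIDUAL OF RECORD — with ★★★ `sum_trace_resYOfRecordPK_Δ2_lettersH`:
  (3.134) holds with `H := (lettersYOfRecordV11K N θ M⋆ 𝔯 x).H`, THE v11 KNIT RECORD's OWN (3.126), for every `𝔯` — in particular at the fixed point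
  `𝔯 := resYOfRecordPK`;
* §4 ON PRINT's CLASS (3.35): `isRealOpY_GpPhysY_parKnitY`, ★ `HDQY_knit_isRealOpY_of_regQY` (the knit `H(U)` is real on `regQY G i c₀ α₀`, `G ≤ U(N)`,
  numerics `c₀ ≤ 10`, `0 ≤ Mα₀`, `0 < α₀′`, `C₀α₀′ ≤ 1/3`, `4α₀′ ≤ c₂′`, `exp(4·800((d+1)+1)²((d+1)+4)·α₀′) < 2`, `K_pl(Mα₀)·L⁴ < α₀′` — dag-n06-l's
  `QknitY_isRealOpY_of_reg335P` and `parKnitY_mem_unitary_of_regQY` BY NAME), ★★ `resYOfRecordPK_Δ2_isSymmTr_of_regQY`, ★★★ `_SU_of_regQY`,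
  `_SU_threshK` (member-law shape over `bg9YP … SU(N)`, threshold numerics folded as in `OpsYRecordV11Thresh`), and the certificate rows at
  `𝔯 := resYOfRecordPK`: ★★★ `lettersYOfRecordV11K_symmDG₁GG_PK_of_regQY ∕ _PK_SU_of_regQY ∕ _PK_SU_threshK`,
  `lettersYOfRecordV11K_isUnit_QGQOfQY_G₁_PK_SU_threshK`.
CONSUMER RECIPE.  dag-n06-d (the knit instance's final residual key): `𝔯 := resYOfRecordPK N θ.toStage3Params M⋆`;
`hsymD := lettersYOfRecordV11K_symmDG₁GG_PK_SU_threshK N θ.toStage3Params M⋆ x hc hα' hα3 hα4 hexp hKa` (the two extra x-free numerics `hα4`, `hexp` are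
binders of dag-n06-l's `qLawsY_qKnitOfRecord`; `hα4` implies the former `hα2`); `hD2sup` then speaks about `delta2OfQY (trDualMatY N) x.toKIdx
(qKnitOfRecord …) (qsKnitOfRecord …) (parKnitY …) (GpPhysY … (parKnitY …)) ((c2YOfRecord …) x).form` (`resYOfRecordPK_Δ2`).  dag-n06-l (`hC1T_knit_of_laws`):
at `Δ2 := fun x => (resYOfRecordPK N θ M⋆ x).Δ2` the binder `hΔ2` is to be keyed to the REGIME, shape `… Reg335 c₀ α₀ U → IsSymmTr 1 ((Δ2 x) U)` —
`resYOfRecordPK_Δ2_isSymmTr_SU_threshK` (exactly like `hparK`): `IsSymmTr 1` of the knit `Δ⁽²⁾(U)` at EVERY `SU(N)`-valued `U` is not a theorem of the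
tree — the reality of print's `Q(U)` of (3.115) is dag-n06-l's theorem ON (3.35) (`QknitY`'s off-class branch is bookkeeping), and so is the unitarity of
`parKnitY(U)`.  The BILINEAR trace symmetry `sum_trace_resYOfRecordPK_Δ2_symm` holds at every `U`.
HONEST SCOPE.  Definitions with bodies and bookkeeping∕algebra over def-Y's letters and dag-n06-l's knit-letter theorems (cited by name, not restated);
[5]'s `C⁽²⁾` enters only through def-Y's typed (22)–(23) `c2YOfRecord` or as a PARAMETER `𝔠`; NO covariance row for the knit `Δ⁽²⁾` (the knit letter's
covariance is corner-keyed and no consumer of record needs it — not claimed); nothing of [B9] or [5] asserted; COUNT-NEUTRAL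
(`--supports stmt-QuantumFields-20541`); N06 NOT discharged; K1⁹ NOT closed.  One finite lattice at a time — nothing continuum ∕ ℝ⁴ ∕ OS ∕ mass gap ∕
Clay.  Cell `pub-ymgap` (HUMAN RULING D-0062), Track A NODE 00, seat `pub-ymgap-node00-def-Y` (g33), 2026-08-30.
-/

noncomputable section

namespace Literature.MathematicalPhysics.QuantumFieldTheory.Balaban1983to89.Node00

open B6KLevelCensusIndexV1 (KIdx kGeo)
open B9PinMembersKLevelV1 (MemberY geo9Y)
open B9Thm311ReadingCoords (IsSymmTr PosDefTr)
open B9Eq3132SectDLetters (HDY)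
open B7Prop2SpecialUnitary (specialUnitaryUnits specialUnitaryUnits_le_unitaryUnits)
open B7Prop2Explicit (C0 c2')
open B9C2FormBoxRegimeY (Kpl)
open B9Eq316AveragingTransposeZd (alphaQ)
open B9Eq3115KnitLetterYOnto (kCol)
open B9B8AveragingJunction (parKnitY)
open B9BackgroundsKLevelV1P (bg9KP bg9YP)
open B9Eq3115KnitLetterYRealReg335 (QknitY_isRealOpY_of_reg335P)
open OpsYQLetter (QFamY QsFamY regQY mem_of_regQY parKnitY_mem_unitary_of_regQY qKnitOfRecord qsKnitOfRecord)
open scoped Matrix Matrix.Norms.L2Operator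

/-! ## §1 `Δ⁽²⁾(U)` of (3.134) over a GENERIC `H`: `delta2OfHY` -/

section Delta2H

variable {d ℓ : ℕ} {hd : 1 ≤ d + 1} {hL : Odd (ℓ + 1) ∧ 1 < ℓ + 1} {b₀ b₁ : ℝ}
variable {𝔸 : Type} [NormedRing 𝔸] [NormedAlgebra ℂ 𝔸] [CompleteSpace 𝔸]
variable (𝔡 : TrDualY 𝔸) (i : KIdx d ℓ hd hL b₀ b₁) (H : CfgY 𝔸 i → ((IBondY i → 𝔸) →ₗ[ℂ] (FBondY i → 𝔸)))

/-- the functional `B ↦ ⟨H(U)B, J(U)⟩_τ` on coarse-bond functions over a generic letter `H` (print: `H = H(U)` of (3.126); `J = J(U)` of (3.117)).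
[cite: Balaban1985BackgroundPropagators, (3.134) p.422, (3.126) p.420, (3.117) p.419] -/
def pairHJOfY (U : CfgY 𝔸 i) : (IBondY i → 𝔸) →ₗ[ℂ] ℂ := (trPairBY 𝔡.τ).flip (JY i U) ∘ₗ H U

/-- the functional, evaluated. [cite: Balaban1985BackgroundPropagators, (3.134) p.422, bookkeeping] -/
@[simp] theorem pairHJOfY_apply (U : CfgY 𝔸 i) (B : IBondY i → 𝔸) : pairHJOfY 𝔡 i H U B = trPairY 𝔡.τ (H U B) (JY i U) := rfl

/-- ★ **`Δ⁽²⁾(U)` OF (3.134) OVER A GENERIC `H`** — *«Let us define ⟨A, Δ⁽²⁾A⟩ = 2⟨HC⁽²⁾(A), J⟩»*: the operator of this quadratic form for the trace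
pairing, `Δ⁽²⁾(U)A = 2·ρ(A′ ↦ ⟨H(U)C⁽²⁾(U; A, A′), J(U)⟩_τ)`, as a function of the letters `H` and `C⁽²⁾` (`OpsYDelta2Form.delta2OfY` is the instance
`H := HDY i parS parB Gp`, `delta2OfY_eq_delta2OfHY`). [cite: Balaban1985BackgroundPropagators, (3.134) p.422, (3.136) p.422] -/
def delta2OfHY (C : CfgY 𝔸 i → (FBondY i → 𝔸) →ₗ[ℂ] (FBondY i → 𝔸) →ₗ[ℂ] (IBondY i → 𝔸)) : BondOpY 𝔸 i := fun U =>
  (2 : ℂ) • (rieszY 𝔡 ∘ₗ LinearMap.llcomp ℂ (FBondY i → 𝔸) (IBondY i → 𝔸) ℂ (pairHJOfY 𝔡 i H U) ∘ₗ C U)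

variable (C : CfgY 𝔸 i → (FBondY i → 𝔸) →ₗ[ℂ] (FBondY i → 𝔸) →ₗ[ℂ] (IBondY i → 𝔸))

/-- FACE: `OpsYDelta2Form.delta2OfY` is `delta2OfHY` at `H := HDY i parS parB Gp` (`rfl`). [cite: Balaban1985BackgroundPropagators, (3.134) p.422, (3.126) p.420, bookkeeping] -/
theorem delta2OfY_eq_delta2OfHY (parS : SiteParY 𝔸 i) (parB : BondParY 𝔸 i) (Gp : SiteOpY 𝔸 i) :
    delta2OfY 𝔡 i parS parB Gp C = delta2OfHY 𝔡 i (HDY i parS parB Gp) C := rfl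

/-- ★ **(3.134) POLARISED ∕ (3.136)** over a generic `H`: `⟨A′, Δ⁽²⁾(U)A⟩_τ = 2⟨H(U)C⁽²⁾(U; A, A′), J(U)⟩_τ`. [cite: Balaban1985BackgroundPropagators, (3.134) p.422, (3.136) p.422] -/
theorem trPairY_delta2OfHY (U : CfgY 𝔸 i) (A A' : FBondY i → 𝔸) :
    trPairY 𝔡.τ A' (delta2OfHY 𝔡 i H C U A) = 2 * trPairY 𝔡.τ (H U (C U A A')) (JY i U) := by
  rw [delta2OfHY, LinearMap.smul_apply, trPairY_smul_right, LinearMap.comp_apply, LinearMap.comp_apply, trPairY_rieszY]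
  rfl

/-- (3.134) verbatim over a generic `H`: `⟨A, Δ⁽²⁾A⟩ = 2⟨HC⁽²⁾(A), J⟩`, `C⁽²⁾(A) = C⁽²⁾(U; A, A)`. [cite: Balaban1985BackgroundPropagators, (3.134) p.422] -/
theorem trPairY_delta2OfHY_self (U : CfgY 𝔸 i) (A : FBondY i → 𝔸) :
    trPairY 𝔡.τ A (delta2OfHY 𝔡 i H C U A) = 2 * trPairY 𝔡.τ (H U (C U A A)) (JY i U) :=
  trPairY_delta2OfHY 𝔡 i H C U A A

/-- (3.136) with `H*` over a generic `H`: `⟨A′, Δ⁽²⁾A⟩_τ = 2⟨C⁽²⁾(A, A′), H†J⟩_τ` (print's «(H*J)(b)», the `τ`-transpose `trAdjY`).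
[cite: Balaban1985BackgroundPropagators, (3.136) p.422 («(H*J)(b)»)] -/
theorem trPairY_delta2OfHY_trAdj (U : CfgY 𝔸 i) (A A' : FBondY i → 𝔸) :
    trPairY 𝔡.τ A' (delta2OfHY 𝔡 i H C U A) = 2 * trPairY 𝔡.τ (C U A A') (trAdjY 𝔡 (H U) (JY i U)) := by
  rw [trPairY_delta2OfHY, trPairY_trAdjY]

/-- `Δ⁽²⁾(U)` over a generic `H` is `τ`-symmetric for a symmetric `C⁽²⁾(U; ·, ·)`. [cite: Balaban1985BackgroundPropagators, (3.134) p.422 (a quadratic form's operator)] -/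
theorem trPairY_delta2OfHY_symm (hC : ∀ (U : CfgY 𝔸 i) (A A' : FBondY i → 𝔸), C U A A' = C U A' A) (U : CfgY 𝔸 i) (A A' : FBondY i → 𝔸) :
    trPairY 𝔡.τ A' (delta2OfHY 𝔡 i H C U A) = trPairY 𝔡.τ A (delta2OfHY 𝔡 i H C U A') := by
  rw [trPairY_delta2OfHY, trPairY_delta2OfHY, hC]

/-- `τ`-symmetry in the shape `⟨Δ⁽²⁾A, B⟩_τ = ⟨A, Δ⁽²⁾B⟩_τ`. [cite: Balaban1985BackgroundPropagators, (3.134) p.422, bookkeeping] -/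
theorem trPairY_delta2OfHY_symm' (hC : ∀ (U : CfgY 𝔸 i) (A A' : FBondY i → 𝔸), C U A A' = C U A' A) (U : CfgY 𝔸 i) (A B : FBondY i → 𝔸) :
    trPairY 𝔡.τ (delta2OfHY 𝔡 i H C U A) B = trPairY 𝔡.τ A (delta2OfHY 𝔡 i H C U B) := by
  rw [trPairY_comm 𝔡.τ 𝔡.τ_comm, trPairY_delta2OfHY_symm 𝔡 i H C hC]

/-- ★ **UNIQUENESS over a generic `H`** — (3.134) DEFINES `Δ⁽²⁾`: a `τ`-symmetric bond-sector operator with the quadratic form `2⟨HC⁽²⁾(A), J⟩` IS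
`delta2OfHY … U` (polarisation + separation). [cite: Balaban1985BackgroundPropagators, (3.134) p.422 («Let us define»)] -/
theorem delta2OfHY_unique (hC : ∀ (U : CfgY 𝔸 i) (A A' : FBondY i → 𝔸), C U A A' = C U A' A) (U : CfgY 𝔸 i)
    (T : (FBondY i → 𝔸) →ₗ[ℂ] (FBondY i → 𝔸)) (hT : ∀ A B : FBondY i → 𝔸, trPairY 𝔡.τ (T A) B = trPairY 𝔡.τ A (T B))
    (h134 : ∀ A : FBondY i → 𝔸, trPairY 𝔡.τ A (T A) = 2 * trPairY 𝔡.τ (H U (C U A A)) (JY i U)) :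
    T = delta2OfHY 𝔡 i H C U := by
  refine LinearMap.ext fun A => trPairY_left_ext 𝔡 fun A' => ?_
  have h2 : (2 : ℂ) ≠ 0 := two_ne_zero
  refine mul_left_cancel₀ h2 ?_
  rw [trPairY_polarize 𝔡 T hT, trPairY_polarize 𝔡 _ (trPairY_delta2OfHY_symm' 𝔡 i H C hC U), h134, h134, h134,
    trPairY_delta2OfHY_self, trPairY_delta2OfHY_self, trPairY_delta2OfHY_self]

/-- ★ **`Δ⁽²⁾(1) = 0`** over a generic `H` — the residual letter's `U = 1` clause as a THEOREM of the construction (`JY_one`: `U = 1 ⇒ J = 0`).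
[cite: Balaban1985BackgroundPropagators, (3.134) p.422, (3.11) p.392, bookkeeping] -/
theorem delta2OfHY_one : delta2OfHY 𝔡 i H C (fun _ _ => 1) = 0 := by
  refine LinearMap.ext fun A => trPairY_left_ext 𝔡 fun A' => ?_
  rw [trPairY_delta2OfHY, JY_one', trPairY_zero_right, mul_zero, LinearMap.zero_apply, trPairY_zero_right]

/-- `Δ⁽²⁾ ≡ 0` over a generic `H` for the flat letter `C⁽²⁾ = 0`. [cite: Balaban1985BackgroundPropagators, (3.134) p.422, bookkeeping] -/
theorem delta2OfHY_flat (U : CfgY 𝔸 i) : delta2OfHY 𝔡 i H (fun _ => 0) U = 0 := by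
  refine LinearMap.ext fun A => trPairY_left_ext 𝔡 fun A' => ?_
  rw [trPairY_delta2OfHY, LinearMap.zero_apply, LinearMap.zero_apply, map_zero, trPairY_zero_left, mul_zero, LinearMap.zero_apply,
    trPairY_zero_right]

end Delta2H

section StarH

variable {d ℓ : ℕ} {hd : 1 ≤ d + 1} {hL : Odd (ℓ + 1) ∧ 1 < ℓ + 1} {b₀ b₁ : ℝ}
variable {𝔸 : Type} [NormedRing 𝔸] [NormedAlgebra ℂ 𝔸] [CompleteSpace 𝔸] [StarRing 𝔸]
variable (𝔡 : TrDualY 𝔸) (i : KIdx d ℓ hd hL b₀ b₁) (H : CfgY 𝔸 i → ((IBondY i → 𝔸) →ₗ[ℂ] (FBondY i → 𝔸)))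
variable (C : CfgY 𝔸 i → (FBondY i → 𝔸) →ₗ[ℂ] (FBondY i → 𝔸) →ₗ[ℂ] (IBondY i → 𝔸))

/-- ★ **`Δ⁽²⁾(U)` over a generic `H` IS REAL FOR REAL LETTERS**: if `C⁽²⁾(U; A⋆, A′⋆) = C⁽²⁾(U; A, A′)⋆`, `H(U)X⋆ = (H(U)X)⋆` and `J(U)⋆ = J(U)`, then
`Δ⁽²⁾(U)A⋆ = (Δ⁽²⁾(U)A)⋆` (for a `⋆`-compatible tracial `τ`) — the proof of `OpsYDelta2Form.delta2OfY_star`, letter for letter.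
[cite: Balaban1985BackgroundPropagators, (3.134) p.422, (3.11) p.392] -/
theorem delta2OfHY_star (hτ : ∀ a : 𝔸, 𝔡.τ (star a) = star (𝔡.τ a)) (U : CfgY 𝔸 i)
    (hC : ∀ A A' : FBondY i → 𝔸, C U (star A) (star A') = star (C U A A')) (hH : ∀ X : IBondY i → 𝔸, H U (star X) = star (H U X))
    (hJ : star (JY i U) = JY i U) (A : FBondY i → 𝔸) :
    delta2OfHY 𝔡 i H C U (star A) = star (delta2OfHY 𝔡 i H C U A) := by
  refine trPairY_left_ext 𝔡 fun Φ => ?_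
  have hC' : C U (star A) Φ = star (C U A (star Φ)) := by simpa only [star_star] using hC A (star Φ)
  have h2 : star (2 : ℂ) = 2 := star_ofNat 2
  have hL : trPairY 𝔡.τ Φ (delta2OfHY 𝔡 i H C U (star A)) = 2 * star (trPairY 𝔡.τ (H U (C U A (star Φ))) (JY i U)) := by
    rw [trPairY_delta2OfHY, hC', hH]
    congr 1
    calc trPairY 𝔡.τ (star (H U (C U A (star Φ)))) (JY i U)
          = trPairY 𝔡.τ (star (H U (C U A (star Φ)))) (star (JY i U)) := by rw [hJ]
      _ = star (trPairY 𝔡.τ (JY i U) (H U (C U A (star Φ)))) := trPairY_star 𝔡.τ hτ _ _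
      _ = star (trPairY 𝔡.τ (H U (C U A (star Φ))) (JY i U)) := by rw [trPairY_comm 𝔡.τ 𝔡.τ_comm]
  have hR : trPairY 𝔡.τ Φ (star (delta2OfHY 𝔡 i H C U A)) = 2 * star (trPairY 𝔡.τ (H U (C U A (star Φ))) (JY i U)) := by
    calc trPairY 𝔡.τ Φ (star (delta2OfHY 𝔡 i H C U A))
          = trPairY 𝔡.τ (star (star Φ)) (star (delta2OfHY 𝔡 i H C U A)) := by rw [star_star]
      _ = star (trPairY 𝔡.τ (delta2OfHY 𝔡 i H C U A) (star Φ)) := trPairY_star 𝔡.τ hτ _ _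
      _ = star (trPairY 𝔡.τ (star Φ) (delta2OfHY 𝔡 i H C U A)) := by rw [trPairY_comm 𝔡.τ 𝔡.τ_comm]
      _ = 2 * star (trPairY 𝔡.τ (H U (C U A (star Φ))) (JY i U)) := by rw [trPairY_delta2OfHY, star_mul, h2, mul_comm]
  rw [hL, hR]

/-- ★ reality of `Δ⁽²⁾(U)` over a generic `H` at a UNITARY background from reality of `C⁽²⁾(U)` and `H(U)` alone (`J(U)⋆ = J(U)` discharged by `star_JY`).
[cite: Balaban1985BackgroundPropagators, (3.134) p.422, (3.11) p.392, p.396 («values in G»)] -/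
theorem delta2OfHY_star_of_unitary [StarModule ℂ 𝔸] (hτ : ∀ a : 𝔸, 𝔡.τ (star a) = star (𝔡.τ a)) {U : CfgY 𝔸 i}
    (hU : ∀ μ y, star ((U μ y : 𝔸ˣ) : 𝔸) = (((U μ y)⁻¹ : 𝔸ˣ) : 𝔸))
    (hC : ∀ A A' : FBondY i → 𝔸, C U (star A) (star A') = star (C U A A')) (hH : ∀ X : IBondY i → 𝔸, H U (star X) = star (H U X))
    (A : FBondY i → 𝔸) : delta2OfHY 𝔡 i H C U (star A) = star (delta2OfHY 𝔡 i H C U A) :=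
  delta2OfHY_star 𝔡 i H C hτ U hC hH (star_JY i hU) A

end StarH

/-! ## §2 `Δ⁽²⁾(U)` over a GENERIC AVERAGING PAIR `(𝔮, 𝔮⋆)`: `delta2OfQY`, and the `Q`-generic reality kit at `M_N(ℂ)` -/

section Delta2Q

variable {d ℓ : ℕ} {hd : 1 ≤ d + 1} {hL : Odd (ℓ + 1) ∧ 1 < ℓ + 1} {b₀ b₁ : ℝ}
variable {𝔸 : Type} [NormedRing 𝔸] [NormedAlgebra ℂ 𝔸] [CompleteSpace 𝔸]
variable (𝔡 : TrDualY 𝔸) (i : KIdx d ℓ hd hL b₀ b₁) (𝔮 : CfgY 𝔸 i → ((FBondY i → 𝔸) →ₗ[ℂ] (IBondY i → 𝔸)))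
  (𝔮s : CfgY 𝔸 i → ((IBondY i → 𝔸) →ₗ[ℂ] (FBondY i → 𝔸))) (parS : SiteParY 𝔸 i) (Gp : SiteOpY 𝔸 i)
  (C : CfgY 𝔸 i → (FBondY i → 𝔸) →ₗ[ℂ] (FBondY i → 𝔸) →ₗ[ℂ] (IBondY i → 𝔸))

/-- ★ **`Δ⁽²⁾[𝔮](U)` OF (3.134) OVER A GENERIC AVERAGING PAIR**: `delta2OfHY` at `H := H[𝔮] = HDQY i 𝔮 𝔮s parS Gp` ((3.126) over the pair, fed the site
transporter `parS` and the site propagator `Gp`). [cite: Balaban1985BackgroundPropagators, (3.134) p.422, (3.126) p.420, (3.115) p.418] -/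
def delta2OfQY : BondOpY 𝔸 i := delta2OfHY 𝔡 i (HDQY i 𝔮 𝔮s parS Gp) C

/-- `delta2OfQY` unfolds (`rfl`). [cite: Balaban1985BackgroundPropagators, (3.134) p.422, bookkeeping] -/
theorem delta2OfQY_eq : delta2OfQY 𝔡 i 𝔮 𝔮s parS Gp C = delta2OfHY 𝔡 i (HDQY i 𝔮 𝔮s parS Gp) C := rfl

/-- FACE: at the straight-contour pair `(QY parB, QsY parB)`, `Δ⁽²⁾[Q] = OpsYDelta2Form.delta2OfY` (`rfl`, through `HDQY_QY`).
[cite: Balaban1985BackgroundPropagators, (3.134) p.422, (3.12)–(3.13) p.392, bookkeeping] -/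
theorem delta2OfQY_QY (parB : BondParY 𝔸 i) : delta2OfQY 𝔡 i (QY i parB) (QsY i parB) parS Gp C = delta2OfY 𝔡 i parS parB Gp C := rfl

/-- ★ (3.134)∕(3.136) over the pair: `⟨A′, Δ⁽²⁾[𝔮](U)A⟩_τ = 2⟨H[𝔮](U)C⁽²⁾(U; A, A′), J(U)⟩_τ`. [cite: Balaban1985BackgroundPropagators, (3.134) p.422, (3.136) p.422] -/
theorem trPairY_delta2OfQY (U : CfgY 𝔸 i) (A A' : FBondY i → 𝔸) :
    trPairY 𝔡.τ A' (delta2OfQY 𝔡 i 𝔮 𝔮s parS Gp C U A) = 2 * trPairY 𝔡.τ (HDQY i 𝔮 𝔮s parS Gp U (C U A A')) (JY i U) :=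
  trPairY_delta2OfHY 𝔡 i (HDQY i 𝔮 𝔮s parS Gp) C U A A'

/-- `Δ⁽²⁾[𝔮](1) = 0`. [cite: Balaban1985BackgroundPropagators, (3.134) p.422, (3.11) p.392, bookkeeping] -/
theorem delta2OfQY_one : delta2OfQY 𝔡 i 𝔮 𝔮s parS Gp C (fun _ _ => 1) = 0 := delta2OfHY_one 𝔡 i (HDQY i 𝔮 𝔮s parS Gp) C

end Delta2Q

section RealQ

variable {d ℓ : ℕ} {hd : 1 ≤ d + 1} {hL : Odd (ℓ + 1) ∧ 1 < ℓ + 1} {b₀ b₁ : ℝ} {N : ℕ}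
variable (i : KIdx d ℓ hd hL b₀ b₁) (U : CfgY (Matrix (Fin N) (Fin N) ℂ) i)
variable (hU : ∀ μ x, ((U μ x : (Matrix (Fin N) (Fin N) ℂ)ˣ) : Matrix (Fin N) (Fin N) ℂ) ∈ unitary (Matrix (Fin N) (Fin N) ℂ))
variable (𝔮 : CfgY (Matrix (Fin N) (Fin N) ℂ) i → ((FBondY i → Matrix (Fin N) (Fin N) ℂ) →ₗ[ℂ] (IBondY i → Matrix (Fin N) (Fin N) ℂ)))
  (𝔮s : CfgY (Matrix (Fin N) (Fin N) ℂ) i → ((IBondY i → Matrix (Fin N) (Fin N) ℂ) →ₗ[ℂ] (FBondY i → Matrix (Fin N) (Fin N) ℂ)))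
  (parS : SiteParY (Matrix (Fin N) (Fin N) ℂ) i) (Gp : SiteOpY (Matrix (Fin N) (Fin N) ℂ) i)
variable (h𝔮 : IsRealOpY (𝔮 U)) (h𝔮s : IsRealOpY (𝔮s U))
  (hS : ∀ z w, ((parS U z w : (Matrix (Fin N) (Fin N) ℂ)ˣ) : Matrix (Fin N) (Fin N) ℂ) ∈ unitary (Matrix (Fin N) (Fin N) ℂ))
  (hGp : IsRealOpY (Gp U))

include hU h𝔮 h𝔮s hS hGp

/-- `G̃⁻¹[𝔮](U) = Δ_π + DRD* + 𝔮⋆a𝔮` is real at a unitary background for a real pair, unitary site transporters and a real `G′`.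
[cite: Balaban1985BackgroundPropagators, (3.122) p.420, p.391 (hermitian-valued functions)] -/
theorem deltaPiAQY_isRealOpY : IsRealOpY (deltaPiAQY i 𝔮 𝔮s parS Gp U) :=
  ((deltaPiY_isRealOpY i U hU parS Gp hS hGp).add ((gradY_isRealOpY i U hU).comp ((RY_isRealOpY i U parS Gp hS hGp).comp
    (divY_isRealOpY i U hU)))).add (h𝔮s.comp ((aY_isRealOpY i).comp h𝔮))

/-- `G̃[𝔮](U)` is real. [cite: Balaban1985BackgroundPropagators, (3.122) p.420] -/
theorem GDQY_isRealOpY : IsRealOpY (GDQY i 𝔮 𝔮s parS Gp U) := (deltaPiAQY_isRealOpY i U hU 𝔮 𝔮s parS Gp h𝔮 h𝔮s hS hGp).ringInverse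

/-- `(𝔮G̃𝔮⋆)(U)` is real. [cite: Balaban1985BackgroundPropagators, (3.123) p.420] -/
theorem QGQQY_isRealOpY : IsRealOpY (QGQQY i 𝔮 𝔮s parS Gp U) := h𝔮.comp ((GDQY_isRealOpY i U hU 𝔮 𝔮s parS Gp h𝔮 h𝔮s hS hGp).comp h𝔮s)

/-- `(𝔮G̃𝔮⋆)⁻¹(U)` is real. [cite: Balaban1985BackgroundPropagators, (3.132) p.422] -/
theorem QGQinvQY_isRealOpY : IsRealOpY (QGQinvQY i 𝔮 𝔮s parS Gp U) := (QGQQY_isRealOpY i U hU 𝔮 𝔮s parS Gp h𝔮 h𝔮s hS hGp).ringInverse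

/-- ★ **`H[𝔮](U) = G̃𝔮⋆(𝔮G̃𝔮⋆)⁻¹` IS REAL** at a unitary background for a real pair, unitary site transporters and a real site propagator.
[cite: Balaban1985BackgroundPropagators, (3.126) p.420, p.391 (hermitian-valued functions)] -/
theorem HDQY_isRealOpY : IsRealOpY (HDQY i 𝔮 𝔮s parS Gp U) :=
  (GDQY_isRealOpY i U hU 𝔮 𝔮s parS Gp h𝔮 h𝔮s hS hGp).comp (h𝔮s.comp (QGQinvQY_isRealOpY i U hU 𝔮 𝔮s parS Gp h𝔮 h𝔮s hS hGp))

end RealQ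

/-! ## §3 At the record: ★★ `resYOfC2Q`, its straight-pair face, and ★★★ the knit residual of record `resYOfRecordPK` -/

section RecordQ

variable (N : ℕ) (θ : Stage3Params) (Mstar : ℕ)

/-- ★★ **THE RESIDUAL FAMILY AS A FUNCTION OF AN AVERAGING PAIR FAMILY, A SITE-TRANSPORTER FAMILY AND `C⁽²⁾`, FED `G′_phys`**: member by member
`Δ⁽²⁾[𝔮 x](U) = delta2OfQY` at the trace-dual fibre of record `M_N(ℂ)`, over `parS x.toKIdx` and `GpPhysY x.toKIdx (parS x.toKIdx)`, with its `U = 1` clause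
PROVED. [cite: Balaban1985BackgroundPropagators, (3.134) p.422, (3.126) p.420, (3.115) p.418] -/
def resYOfC2Q (𝔮 : QFamY N θ) (𝔮s : QsFamY N θ) (parS : ∀ i : KIdx θ.d₆ θ.ℓ₆ θ.hd' θ.hL' θ.b₀ θ.b₁, SiteParY (Matrix (Fin N) (Fin N) ℂ) i)
    (𝔠 : C2Y N θ Mstar) : ResY N θ Mstar := fun x =>
  ⟨delta2OfQY (trDualMatY N) x.toKIdx (𝔮 x.toKIdx) (𝔮s x.toKIdx) (parS x.toKIdx) (GpPhysY x.toKIdx (parS x.toKIdx)) (𝔠 x).form,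
    delta2OfQY_one (trDualMatY N) x.toKIdx (𝔮 x.toKIdx) (𝔮s x.toKIdx) (parS x.toKIdx) (GpPhysY x.toKIdx (parS x.toKIdx)) (𝔠 x).form⟩

variable (𝔮 : QFamY N θ) (𝔮s : QsFamY N θ) (parS : ∀ i : KIdx θ.d₆ θ.ℓ₆ θ.hd' θ.hL' θ.b₀ θ.b₁, SiteParY (Matrix (Fin N) (Fin N) ℂ) i)
  (𝔠 : C2Y N θ Mstar)

/-- ★ the family's `Δ⁽²⁾` at a member, unfolded (`rfl`). [cite: Balaban1985BackgroundPropagators, (3.134) p.422, bookkeeping] -/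
theorem resYOfC2Q_Δ2 (x : MemberY θ.d₆ θ.ℓ₆ θ.hd' θ.hL' θ.b₀ θ.b₁ Mstar) :
    (resYOfC2Q N θ Mstar 𝔮 𝔮s parS 𝔠 x).Δ2 =
      delta2OfQY (trDualMatY N) x.toKIdx (𝔮 x.toKIdx) (𝔮s x.toKIdx) (parS x.toKIdx) (GpPhysY x.toKIdx (parS x.toKIdx)) (𝔠 x).form := rfl

/-- ★ FACE: **TODAY's RESIDUAL OF RECORD IS THE STRAIGHT-PAIR INSTANCE** — at `(QY ∘ parBY, QsY ∘ parBY)` over `parSymY` the family's `Δ⁽²⁾` is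
`OpsYDelta2FormP.resYOfC2P`'s, member by member (definitionally; `delta2OfQY_QY`). [cite: Balaban1985BackgroundPropagators, (3.134) p.422, (3.12)–(3.13) p.392, bookkeeping] -/
theorem resYOfC2Q_straight_Δ2 (x : MemberY θ.d₆ θ.ℓ₆ θ.hd' θ.hL' θ.b₀ θ.b₁ Mstar) :
    (resYOfC2Q N θ Mstar (fun i => QY i (parBY i)) (fun i => QsY i (parBY i)) (fun i => parSymY i) 𝔠 x).Δ2 = (resYOfC2P N θ Mstar 𝔠 x).Δ2 :=
  delta2OfQY_QY (trDualMatY N) x.toKIdx (parSymY x.toKIdx) (GpPhysY x.toKIdx (parSymY x.toKIdx)) (𝔠 x).form (parBY x.toKIdx)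

/-- ★ (3.134) at the record over the pair family, in matrix traces: `Σ_b tr(A′(b)·(Δ⁽²⁾(U)A)(b)) = 2·Σ_b tr((H[𝔮 x](U)C⁽²⁾(U; A, A′))(b)·J(U)(b))`.
[cite: Balaban1985BackgroundPropagators, (3.134) p.422, (3.136) p.422] -/
theorem sum_trace_resYOfC2Q_Δ2 (x : MemberY θ.d₆ θ.ℓ₆ θ.hd' θ.hL' θ.b₀ θ.b₁ Mstar) (U : CfgY (Matrix (Fin N) (Fin N) ℂ) x.toKIdx)
    (A A' : FBondY x.toKIdx → Matrix (Fin N) (Fin N) ℂ) :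
    ∑ b, Matrix.trace (A' b * (resYOfC2Q N θ Mstar 𝔮 𝔮s parS 𝔠 x).Δ2 U A b) =
      2 * ∑ b, Matrix.trace (HDQY x.toKIdx (𝔮 x.toKIdx) (𝔮s x.toKIdx) (parS x.toKIdx) (GpPhysY x.toKIdx (parS x.toKIdx)) U ((𝔠 x).form U A A') b *
        JY x.toKIdx U b) :=
  trPairY_delta2OfQY (trDualMatY N) x.toKIdx (𝔮 x.toKIdx) (𝔮s x.toKIdx) (parS x.toKIdx) (GpPhysY x.toKIdx (parS x.toKIdx)) (𝔠 x).form U A A'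

/-- the family's `Δ⁽²⁾(U)` is trace-symmetric at EVERY background (bilinear symmetry; no reality needed). [cite: Balaban1985BackgroundPropagators, (3.134) p.422] -/
theorem sum_trace_resYOfC2Q_Δ2_symm (x : MemberY θ.d₆ θ.ℓ₆ θ.hd' θ.hL' θ.b₀ θ.b₁ Mstar) (U : CfgY (Matrix (Fin N) (Fin N) ℂ) x.toKIdx)
    (A B : FBondY x.toKIdx → Matrix (Fin N) (Fin N) ℂ) :
    ∑ b, Matrix.trace ((resYOfC2Q N θ Mstar 𝔮 𝔮s parS 𝔠 x).Δ2 U A b * B b) = ∑ b, Matrix.trace (A b * (resYOfC2Q N θ Mstar 𝔮 𝔮s parS 𝔠 x).Δ2 U B b) :=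
  trPairY_delta2OfHY_symm' (trDualMatY N) x.toKIdx
    (HDQY x.toKIdx (𝔮 x.toKIdx) (𝔮s x.toKIdx) (parS x.toKIdx) (GpPhysY x.toKIdx (parS x.toKIdx))) (𝔠 x).form (𝔠 x).symm U A B

/-- the flat `C⁽²⁾` family reproduces the flat residual family's `Δ⁽²⁾ = 0`, for every pair. [cite: Balaban1985BackgroundPropagators, (3.134) p.422, bookkeeping] -/
theorem resYOfC2Q_flat_Δ2 (x : MemberY θ.d₆ θ.ℓ₆ θ.hd' θ.hL' θ.b₀ θ.b₁ Mstar) (U : CfgY (Matrix (Fin N) (Fin N) ℂ) x.toKIdx) :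
    (resYOfC2Q N θ Mstar 𝔮 𝔮s parS (c2Y_flat N θ Mstar) x).Δ2 U = (resY_flat N θ Mstar x).Δ2 U :=
  delta2OfHY_flat (trDualMatY N) x.toKIdx (HDQY x.toKIdx (𝔮 x.toKIdx) (𝔮s x.toKIdx) (parS x.toKIdx) (GpPhysY x.toKIdx (parS x.toKIdx))) U

/-- ★ the family's `Δ⁽²⁾(U)` IS REAL at a unitary-valued `U` for a real `C⁽²⁾(U)` and a real `H[𝔮 x](U)` (the latter displayed: `HDQY_isRealOpY` discharges it
from the pair's reality). [cite: Balaban1985BackgroundPropagators, (3.134) p.422, p.396 («values in G»)] -/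
theorem resYOfC2Q_Δ2_star (x : MemberY θ.d₆ θ.ℓ₆ θ.hd' θ.hL' θ.b₀ θ.b₁ Mstar) {U : CfgY (Matrix (Fin N) (Fin N) ℂ) x.toKIdx}
    (hU : ∀ μ y, U μ y ∈ B7Prop2Explicit.unitaryUnits (Matrix (Fin N) (Fin N) ℂ))
    (hC : ∀ A A' : FBondY x.toKIdx → Matrix (Fin N) (Fin N) ℂ, (𝔠 x).form U (star A) (star A') = star ((𝔠 x).form U A A'))
    (hH : IsRealOpY (HDQY x.toKIdx (𝔮 x.toKIdx) (𝔮s x.toKIdx) (parS x.toKIdx) (GpPhysY x.toKIdx (parS x.toKIdx)) U))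
    (A : FBondY x.toKIdx → Matrix (Fin N) (Fin N) ℂ) :
    (resYOfC2Q N θ Mstar 𝔮 𝔮s parS 𝔠 x).Δ2 U (star A) = star ((resYOfC2Q N θ Mstar 𝔮 𝔮s parS 𝔠 x).Δ2 U A) :=
  delta2OfHY_star_of_unitary (trDualMatY N) x.toKIdx _ (𝔠 x).form trDualMatY_τ_star (star_eq_inv_of_mem_unitaryUnits x.toKIdx hU) hC hH A

/-- ★★ the family's `Δ⁽²⁾(U)` IS SYMMETRIC IN def-Y's HERMITIAN CURRENCY (`IsSymmTr 1`) at a unitary-valued background, modulo the displayed reality of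
`C⁽²⁾(U)` and of `H[𝔮 x](U)`. [cite: Balaban1985BackgroundPropagators, (3.134) p.422, Thm 3.11 p.416, (3.153) p.426] -/
theorem resYOfC2Q_Δ2_isSymmTr (x : MemberY θ.d₆ θ.ℓ₆ θ.hd' θ.hL' θ.b₀ θ.b₁ Mstar) {U : CfgY (Matrix (Fin N) (Fin N) ℂ) x.toKIdx}
    (hU : ∀ μ y, U μ y ∈ B7Prop2Explicit.unitaryUnits (Matrix (Fin N) (Fin N) ℂ))
    (hC : ∀ A A' : FBondY x.toKIdx → Matrix (Fin N) (Fin N) ℂ, (𝔠 x).form U (star A) (star A') = star ((𝔠 x).form U A A'))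
    (hH : IsRealOpY (HDQY x.toKIdx (𝔮 x.toKIdx) (𝔮s x.toKIdx) (parS x.toKIdx) (GpPhysY x.toKIdx (parS x.toKIdx)) U)) :
    IsSymmTr (fun _ => (1 : ℝ)) ((resYOfC2Q N θ Mstar 𝔮 𝔮s parS 𝔠 x).Δ2 U) :=
  isSymmTr_of_trSymm_of_real _ (sum_trace_resYOfC2Q_Δ2_symm N θ Mstar 𝔮 𝔮s parS 𝔠 x U) (resYOfC2Q_Δ2_star N θ Mstar 𝔮 𝔮s parS 𝔠 x hU hC hH)

end RecordQ

section RecordKnit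

variable (N : ℕ) [Nonempty (Fin N)] (θ : Stage3Params) (Mstar : ℕ)

/-- ★★ **THE RESIDUAL FAMILY AT PRINT's KNIT PAIR OF RECORD, AS A FUNCTION OF `C⁽²⁾`**: `resYOfC2Q` at `(qKnitOfRecord, qsKnitOfRecord)` over print's knit
transporter `parKnitY`, fed `G′_phys = GpPhysY (parKnitY)` — the `H` of the v11 knit record (`covLettersY_v11_H`).
[cite: Balaban1985BackgroundPropagators, (3.134) p.422, (3.126) p.420, (3.115) p.418] [cite: Balaban1985Averaging, (15) p.19, Prop. 2 p.26] -/
def resYOfC2PK (𝔠 : C2Y N θ Mstar) : ResY N θ Mstar := resYOfC2Q N θ Mstar (qKnitOfRecord N θ) (qsKnitOfRecord N θ) (fun i => parKnitY i) 𝔠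

/-- ★★★ **THE KNIT RESIDUAL OF RECORD** `Δ⁽²⁾(U)` of (3.134): `resYOfC2PK` at def-Y's `C⁽²⁾` of record `c2YOfRecord` ([5] (22)–(23)) — the v11 knit
record's residual datum built from ITS OWN `H` (3.126). [cite: Balaban1985BackgroundPropagators, (3.134) p.422, (3.126) p.420, (3.115) p.418]
[cite: Balaban1985Averaging, (22)–(23) p.21, (15) p.19] -/
def resYOfRecordPK : ResY N θ Mstar := resYOfC2PK N θ Mstar (c2YOfRecord N θ Mstar)

/-- `resYOfRecordPK` unfolds (`rfl`). [cite: Balaban1985BackgroundPropagators, (3.134) p.422, bookkeeping] -/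
theorem resYOfRecordPK_eq : resYOfRecordPK N θ Mstar =
    resYOfC2Q N θ Mstar (qKnitOfRecord N θ) (qsKnitOfRecord N θ) (fun i => parKnitY i) (c2YOfRecord N θ Mstar) := rfl

/-- ★ the knit family's `Δ⁽²⁾` at a member, unfolded (`rfl`). [cite: Balaban1985BackgroundPropagators, (3.134) p.422, bookkeeping] -/
theorem resYOfC2PK_Δ2 (𝔠 : C2Y N θ Mstar) (x : MemberY θ.d₆ θ.ℓ₆ θ.hd' θ.hL' θ.b₀ θ.b₁ Mstar) :
    (resYOfC2PK N θ Mstar 𝔠 x).Δ2 = delta2OfQY (trDualMatY N) x.toKIdx (qKnitOfRecord N θ x.toKIdx) (qsKnitOfRecord N θ x.toKIdx) (parKnitY x.toKIdx)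
      (GpPhysY x.toKIdx (parKnitY x.toKIdx)) (𝔠 x).form := rfl

/-- ★★ the knit residual of record's `Δ⁽²⁾` at a member, unfolded (`rfl`) — the object dag-n06-d's `hD2sup` speaks about at `𝔯 := resYOfRecordPK`.
[cite: Balaban1985BackgroundPropagators, (3.134) p.422, bookkeeping] -/
theorem resYOfRecordPK_Δ2 (x : MemberY θ.d₆ θ.ℓ₆ θ.hd' θ.hL' θ.b₀ θ.b₁ Mstar) :
    (resYOfRecordPK N θ Mstar x).Δ2 = delta2OfQY (trDualMatY N) x.toKIdx (qKnitOfRecord N θ x.toKIdx) (qsKnitOfRecord N θ x.toKIdx) (parKnitY x.toKIdx)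
      (GpPhysY x.toKIdx (parKnitY x.toKIdx)) (c2YOfRecord N θ Mstar x).form := rfl

/-- ★★ (3.134) for the knit residual of record, in matrix traces, with the knit `H[𝔮](U)` spelled out.
[cite: Balaban1985BackgroundPropagators, (3.134) p.422, (3.136) p.422, (3.126) p.420] -/
theorem sum_trace_resYOfRecordPK_Δ2 (x : MemberY θ.d₆ θ.ℓ₆ θ.hd' θ.hL' θ.b₀ θ.b₁ Mstar) (U : CfgY (Matrix (Fin N) (Fin N) ℂ) x.toKIdx)
    (A A' : FBondY x.toKIdx → Matrix (Fin N) (Fin N) ℂ) :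
    ∑ b, Matrix.trace (A' b * (resYOfRecordPK N θ Mstar x).Δ2 U A b) =
      2 * ∑ b, Matrix.trace (HDQY x.toKIdx (qKnitOfRecord N θ x.toKIdx) (qsKnitOfRecord N θ x.toKIdx) (parKnitY x.toKIdx)
        (GpPhysY x.toKIdx (parKnitY x.toKIdx)) U ((c2YOfRecord N θ Mstar x).form U A A') b * JY x.toKIdx U b) :=
  sum_trace_resYOfC2Q_Δ2 N θ Mstar (qKnitOfRecord N θ) (qsKnitOfRecord N θ) (fun i => parKnitY i) (c2YOfRecord N θ Mstar) x U A A'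

/-- ★★★ **(3.134) AT THE v11 KNIT RECORD's OWN `H`**: for EVERY residual datum `𝔯`, the knit residual of record satisfies
`Σ_b tr(A′(b)·(Δ⁽²⁾(U)A)(b)) = 2·Σ_b tr((H(U)C⁽²⁾(U; A, A′))(b)·J(U)(b))` with `H := (lettersYOfRecordV11K N θ M⋆ 𝔯 x).H` — print's Sect. D closed on itself
at the knit pair (in particular at `𝔯 := resYOfRecordPK`). [cite: Balaban1985BackgroundPropagators, (3.134) p.422, (3.126) p.420, (3.128) p.421] -/
theorem sum_trace_resYOfRecordPK_Δ2_lettersH (𝔯 : ResY N θ Mstar) (x : MemberY θ.d₆ θ.ℓ₆ θ.hd' θ.hL' θ.b₀ θ.b₁ Mstar)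
    (U : CfgY (Matrix (Fin N) (Fin N) ℂ) x.toKIdx) (A A' : FBondY x.toKIdx → Matrix (Fin N) (Fin N) ℂ) :
    ∑ b, Matrix.trace (A' b * (resYOfRecordPK N θ Mstar x).Δ2 U A b) =
      2 * ∑ b, Matrix.trace ((lettersYOfRecordV11K N θ Mstar 𝔯 x).H U ((c2YOfRecord N θ Mstar x).form U A A') b * JY x.toKIdx U b) := by
  rw [(lettersYOfRecordV11K_sectDE N θ Mstar 𝔯 x).2.2.1]
  exact sum_trace_resYOfRecordPK_Δ2 N θ Mstar x U A A'

/-- the knit residual of record's `Δ⁽²⁾(U)` is trace-symmetric at EVERY background. [cite: Balaban1985BackgroundPropagators, (3.134) p.422] -/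
theorem sum_trace_resYOfRecordPK_Δ2_symm (x : MemberY θ.d₆ θ.ℓ₆ θ.hd' θ.hL' θ.b₀ θ.b₁ Mstar) (U : CfgY (Matrix (Fin N) (Fin N) ℂ) x.toKIdx)
    (A B : FBondY x.toKIdx → Matrix (Fin N) (Fin N) ℂ) :
    ∑ b, Matrix.trace ((resYOfRecordPK N θ Mstar x).Δ2 U A b * B b) = ∑ b, Matrix.trace (A b * (resYOfRecordPK N θ Mstar x).Δ2 U B b) :=
  sum_trace_resYOfC2Q_Δ2_symm N θ Mstar (qKnitOfRecord N θ) (qsKnitOfRecord N θ) (fun i => parKnitY i) (c2YOfRecord N θ Mstar) x U A B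

/-- the flat `C⁽²⁾` family at the knit pair reproduces the flat residual family's `Δ⁽²⁾ = 0`. [cite: Balaban1985BackgroundPropagators, (3.134) p.422, bookkeeping] -/
theorem resYOfC2PK_flat_Δ2 (x : MemberY θ.d₆ θ.ℓ₆ θ.hd' θ.hL' θ.b₀ θ.b₁ Mstar) (U : CfgY (Matrix (Fin N) (Fin N) ℂ) x.toKIdx) :
    (resYOfC2PK N θ Mstar (c2Y_flat N θ Mstar) x).Δ2 U = (resY_flat N θ Mstar x).Δ2 U :=
  resYOfC2Q_flat_Δ2 N θ Mstar (qKnitOfRecord N θ) (qsKnitOfRecord N θ) (fun i => parKnitY i) x U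

end RecordKnit

/-! ## §4 On print's class (3.35): reality of the knit `H(U)`, ★★★ `IsSymmTr 1` of the knit residual of record, and the certificate rows at `𝔯 := resYOfRecordPK` -/

section KnitRegimeIdx

variable {N : ℕ} [Nonempty (Fin N)] {θ : Stage3Params} (i : KIdx θ.d₆ θ.ℓ₆ θ.hd' θ.hL' θ.b₀ θ.b₁) {G : Subgroup (Matrix (Fin N) (Fin N) ℂ)ˣ}

omit [Nonempty (Fin N)] in
/-- `G′_phys(U) = η²·G′(U)` over print's knit transporter is real at a `G`-valued background with `G`-valued knit legs, `G ≤ U(N)`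
(`IsRealOpY.smul_real` on def-Y's `GpY_isRealOpY`). [cite: Balaban1985BackgroundPropagators, (3.24)–(3.25) p.394, p.391 (hermitian-valued functions)] [cite: Balaban1985Averaging, Prop. 2 p.26] -/
theorem isRealOpY_GpPhysY_parKnitY (hG : G ≤ B7Prop2Explicit.unitaryUnits (Matrix (Fin N) (Fin N) ℂ)) {U : CfgY (Matrix (Fin N) (Fin N) ℂ) i}
    (hU : ∀ μ x, U μ x ∈ G) (hpar : ∀ z w : SiteY i, parKnitY i U z w ∈ G) : IsRealOpY (GpPhysY i (parKnitY i) U) := by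
  rw [GpPhysY_apply]
  exact IsRealOpY.smul_real _ (GpY_isRealOpY i U (mem_unitary_of_mem_unitaryUnits i fun μ x => hG (hU μ x)) (parKnitY i)
    fun z w => B7Prop2Explicit.mem_unitaryUnits.mp (hG (hpar z w)))

/-- ★ **THE KNIT `H(U)` IS REAL ON PRINT's CLASS (3.35)**: `H[𝔮](U) = HDQY` over `(qKnitOfRecord, qsKnitOfRecord)`, `parKnitY`, `G′_phys` is real at every
background of `regQY G i c₀ α₀`, `G ≤ U(N)`, under the x-free numerics `c₀ ≤ 10`, `0 ≤ Mα₀`, `0 < α₀′`, `C₀α₀′ ≤ 1/3`, `4α₀′ ≤ c₂′`,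
`exp(4·800((d+1)+1)²((d+1)+4)·α₀′) < 2`, `K_pl(Mα₀)·L⁴ < α₀′` — the reality of print's `Q(U)` (dag-n06-l's `QknitY_isRealOpY_of_reg335P`), of its trace
adjoint (`IsRealOpY.adjTrY`), and the unitarity of the knit legs (`parKnitY_mem_unitary_of_regQY`) BY NAME, assembled by `HDQY_isRealOpY`.
[cite: Balaban1985BackgroundPropagators, (3.126) p.420, (3.115) p.418, (3.35) p.396, p.391] [cite: Balaban1985Averaging, (15)–(23) pp.19–21, Prop. 2 p.26] -/
theorem HDQY_knit_isRealOpY_of_regQY (hGU : G ≤ B7Prop2Explicit.unitaryUnits (Matrix (Fin N) (Fin N) ℂ)) {c₀ α₀ : ℝ} (hc : c₀ ≤ 10)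
    (hMα : 0 ≤ (kGeo i).M * α₀) {α₀' : ℝ} (hα' : 0 < α₀') (hα3 : C0 (θ.d₆ + 1) * α₀' ≤ 1 / 3) (hα4 : 4 * α₀' ≤ c2' (θ.d₆ + 1) (θ.ℓ₆ + 1))
    (hexp : Real.exp (4 * (800 * (((θ.d₆ + 1 : ℕ) : ℝ) + 1) ^ 2 * (((θ.d₆ + 1 : ℕ) : ℝ) + 4)) * α₀') < 2)
    (hK : Kpl i ((kGeo i).M * α₀) * (kGeo i).L ^ 4 < α₀') {U : CfgY (Matrix (Fin N) (Fin N) ℂ) i} (hU : regQY G i c₀ α₀ U) :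
    IsRealOpY (HDQY i (qKnitOfRecord N θ i) (qsKnitOfRecord N θ i) (parKnitY i) (GpPhysY i (parKnitY i)) U) := by
  have hGv : ∀ μ z, U μ z ∈ B7Prop2Explicit.unitaryUnits (Matrix (Fin N) (Fin N) ℂ) := fun μ z => hGU (mem_of_regQY (i := i) hU μ z)
  have hα2 : 2 * α₀' ≤ c2' (θ.d₆ + 1) (θ.ℓ₆ + 1) := by linarith
  have hpar : ∀ z w : SiteY i, parKnitY i U z w ∈ B7Prop2Explicit.unitaryUnits (Matrix (Fin N) (Fin N) ℂ) :=
    parKnitY_mem_unitary_of_regQY i (unitBddY_of_le_unitaryUnits hGU) hGU hc hMα hα' hα3 hα2 hK hU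
  have h𝔮 : IsRealOpY (qKnitOfRecord N θ i U) := QknitY_isRealOpY_of_reg335P i hGU hc hMα hU hα' hα3 hα4 hexp hK
  exact HDQY_isRealOpY i U (mem_unitary_of_mem_unitaryUnits i hGv) _ _ (parKnitY i) _ h𝔮 h𝔮.adjTrY
    (fun z w => B7Prop2Explicit.mem_unitaryUnits.mp (hpar z w)) (isRealOpY_GpPhysY_parKnitY i le_rfl hGv hpar)

end KnitRegimeIdx

section KnitRegimeRecord

variable (N : ℕ) [Nonempty (Fin N)] (θ : Stage3Params) (Mstar : ℕ) {G : Subgroup (Matrix (Fin N) (Fin N) ℂ)ˣ}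

/-- ★★ **THE KNIT RESIDUAL OF RECORD IS REAL ON PRINT's CLASS**: `Δ⁽²⁾(U)A⋆ = (Δ⁽²⁾(U)A)⋆` at every background of `regQY G x c₀ α₀` (`G ≤ U(N)`, numerics as in
`HDQY_knit_isRealOpY_of_regQY`) — reality of def-Y's `C⁽²⁾` of record at every `U` (`c2YOfRecord_form_apply_star`), of the knit `H(U)` on the class.
[cite: Balaban1985BackgroundPropagators, (3.134) p.422, (3.35) p.396, p.391] [cite: Balaban1985Averaging, (22)–(23) p.21, Prop. 2 p.26] -/
theorem resYOfRecordPK_Δ2_star_of_regQY (hGU : G ≤ B7Prop2Explicit.unitaryUnits (Matrix (Fin N) (Fin N) ℂ)) {c₀ α₀ : ℝ} (hc : c₀ ≤ 10)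
    (x : MemberY θ.d₆ θ.ℓ₆ θ.hd' θ.hL' θ.b₀ θ.b₁ Mstar) (hMα : 0 ≤ (kGeo x.toKIdx).M * α₀) {α₀' : ℝ} (hα' : 0 < α₀')
    (hα3 : C0 (θ.d₆ + 1) * α₀' ≤ 1 / 3) (hα4 : 4 * α₀' ≤ c2' (θ.d₆ + 1) (θ.ℓ₆ + 1))
    (hexp : Real.exp (4 * (800 * (((θ.d₆ + 1 : ℕ) : ℝ) + 1) ^ 2 * (((θ.d₆ + 1 : ℕ) : ℝ) + 4)) * α₀') < 2)
    (hK : Kpl x.toKIdx ((kGeo x.toKIdx).M * α₀) * (kGeo x.toKIdx).L ^ 4 < α₀') {U : CfgY (Matrix (Fin N) (Fin N) ℂ) x.toKIdx}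
    (hU : regQY G x.toKIdx c₀ α₀ U) (A : FBondY x.toKIdx → Matrix (Fin N) (Fin N) ℂ) :
    (resYOfRecordPK N θ Mstar x).Δ2 U (star A) = star ((resYOfRecordPK N θ Mstar x).Δ2 U A) :=
  resYOfC2Q_Δ2_star N θ Mstar (qKnitOfRecord N θ) (qsKnitOfRecord N θ) (fun i => parKnitY i) (c2YOfRecord N θ Mstar) x
    (fun μ z => hGU (mem_of_regQY (i := x.toKIdx) hU μ z)) (c2YOfRecord_form_apply_star N θ Mstar x U)
    (HDQY_knit_isRealOpY_of_regQY x.toKIdx hGU hc hMα hα' hα3 hα4 hexp hK hU) A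

/-- the knit residual of record is a real operator on print's class. [cite: Balaban1985BackgroundPropagators, (3.134) p.422, (3.35) p.396, bookkeeping] -/
theorem resYOfRecordPK_Δ2_isRealOpY_of_regQY (hGU : G ≤ B7Prop2Explicit.unitaryUnits (Matrix (Fin N) (Fin N) ℂ)) {c₀ α₀ : ℝ} (hc : c₀ ≤ 10)
    (x : MemberY θ.d₆ θ.ℓ₆ θ.hd' θ.hL' θ.b₀ θ.b₁ Mstar) (hMα : 0 ≤ (kGeo x.toKIdx).M * α₀) {α₀' : ℝ} (hα' : 0 < α₀')
    (hα3 : C0 (θ.d₆ + 1) * α₀' ≤ 1 / 3) (hα4 : 4 * α₀' ≤ c2' (θ.d₆ + 1) (θ.ℓ₆ + 1))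
    (hexp : Real.exp (4 * (800 * (((θ.d₆ + 1 : ℕ) : ℝ) + 1) ^ 2 * (((θ.d₆ + 1 : ℕ) : ℝ) + 4)) * α₀') < 2)
    (hK : Kpl x.toKIdx ((kGeo x.toKIdx).M * α₀) * (kGeo x.toKIdx).L ^ 4 < α₀') {U : CfgY (Matrix (Fin N) (Fin N) ℂ) x.toKIdx}
    (hU : regQY G x.toKIdx c₀ α₀ U) : IsRealOpY ((resYOfRecordPK N θ Mstar x).Δ2 U) :=
  fun A => resYOfRecordPK_Δ2_star_of_regQY N θ Mstar hGU hc x hMα hα' hα3 hα4 hexp hK hU A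

/-- ★★ **THE KNIT RESIDUAL OF RECORD IS SYMMETRIC IN def-Y's HERMITIAN CURRENCY ON PRINT's CLASS**: `IsSymmTr 1 (Δ⁽²⁾(U))` at every background of
`regQY G x c₀ α₀`, `G ≤ U(N)`, under the x-free numerics — so `G₁ ∕ 𝔊` of the v11 knit record over `𝔯 := resYOfRecordPK` are symmetric there.
[cite: Balaban1985BackgroundPropagators, (3.134) p.422, Thm 3.11 p.416, (3.153) p.426, (3.35) p.396] [cite: Balaban1985Averaging, (15)–(23) pp.19–21, Prop. 2 p.26] -/
theorem resYOfRecordPK_Δ2_isSymmTr_of_regQY (hGU : G ≤ B7Prop2Explicit.unitaryUnits (Matrix (Fin N) (Fin N) ℂ)) {c₀ α₀ : ℝ} (hc : c₀ ≤ 10)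
    (x : MemberY θ.d₆ θ.ℓ₆ θ.hd' θ.hL' θ.b₀ θ.b₁ Mstar) (hMα : 0 ≤ (kGeo x.toKIdx).M * α₀) {α₀' : ℝ} (hα' : 0 < α₀')
    (hα3 : C0 (θ.d₆ + 1) * α₀' ≤ 1 / 3) (hα4 : 4 * α₀' ≤ c2' (θ.d₆ + 1) (θ.ℓ₆ + 1))
    (hexp : Real.exp (4 * (800 * (((θ.d₆ + 1 : ℕ) : ℝ) + 1) ^ 2 * (((θ.d₆ + 1 : ℕ) : ℝ) + 4)) * α₀') < 2)
    (hK : Kpl x.toKIdx ((kGeo x.toKIdx).M * α₀) * (kGeo x.toKIdx).L ^ 4 < α₀') {U : CfgY (Matrix (Fin N) (Fin N) ℂ) x.toKIdx}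
    (hU : regQY G x.toKIdx c₀ α₀ U) : IsSymmTr (fun _ => (1 : ℝ)) ((resYOfRecordPK N θ Mstar x).Δ2 U) :=
  isSymmTr_of_trSymm_of_real _ (sum_trace_resYOfRecordPK_Δ2_symm N θ Mstar x U)
    (resYOfRecordPK_Δ2_star_of_regQY N θ Mstar hGU hc x hMα hα' hα3 hα4 hexp hK hU)

/-- ★★★ at `G := SU(N)`: the knit residual of record is symmetric at every background of `regQY SU(N) x c₀ α₀` under the x-free numerics.
[cite: Balaban1985BackgroundPropagators, (3.134) p.422, Thm 3.11 p.416, (3.35) p.396, pp.389–390 (G ⊂ U(N))] [cite: Balaban1985Averaging, Prop. 2 p.26] -/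
theorem resYOfRecordPK_Δ2_isSymmTr_SU_of_regQY {c₀ α₀ : ℝ} (hc : c₀ ≤ 10) (x : MemberY θ.d₆ θ.ℓ₆ θ.hd' θ.hL' θ.b₀ θ.b₁ Mstar)
    (hMα : 0 ≤ (kGeo x.toKIdx).M * α₀) {α₀' : ℝ} (hα' : 0 < α₀') (hα3 : C0 (θ.d₆ + 1) * α₀' ≤ 1 / 3) (hα4 : 4 * α₀' ≤ c2' (θ.d₆ + 1) (θ.ℓ₆ + 1))
    (hexp : Real.exp (4 * (800 * (((θ.d₆ + 1 : ℕ) : ℝ) + 1) ^ 2 * (((θ.d₆ + 1 : ℕ) : ℝ) + 4)) * α₀') < 2)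
    (hK : Kpl x.toKIdx ((kGeo x.toKIdx).M * α₀) * (kGeo x.toKIdx).L ^ 4 < α₀') {U : CfgY (Matrix (Fin N) (Fin N) ℂ) x.toKIdx}
    (hU : regQY (specialUnitaryUnits (Fin N)) x.toKIdx c₀ α₀ U) : IsSymmTr (fun _ => (1 : ℝ)) ((resYOfRecordPK N θ Mstar x).Δ2 U) :=
  resYOfRecordPK_Δ2_isSymmTr_of_regQY N θ Mstar specialUnitaryUnits_le_unitaryUnits hc x hMα hα' hα3 hα4 hexp hK hU

/-- ★★★ **dag-n06-l's `hΔ2` FOR THE KNIT RESIDUAL OF RECORD, REGIME-KEYED, threshold numerics folded** (member-law shape over print's member class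
`bg9YP … SU(N)`, exactly like `hparK`): `∀ α₀ > 0, Mα₀ ≤ a → ∀ U ∈ (3.35), IsSymmTr 1 (Δ⁽²⁾(U))` under `c₀ ≤ 10`, `0 < α₀′`, `C₀α₀′ ≤ 1/3`, `4α₀′ ≤ c₂′`,
`exp(…α₀′) < 2`, `K_pl(a)·L⁴ < α₀′`. [cite: Balaban1985BackgroundPropagators, (3.134) p.422, Thm 3.11 p.416, (3.35) p.396] [cite: Balaban1985Averaging, Prop. 2 p.26] -/
theorem resYOfRecordPK_Δ2_isSymmTr_SU_threshK (x : MemberY θ.d₆ θ.ℓ₆ θ.hd' θ.hL' θ.b₀ θ.b₁ Mstar) {c₀ : ℝ} (hc : c₀ ≤ 10) {a α₀' : ℝ} (hα' : 0 < α₀')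
    (hα3 : C0 (θ.d₆ + 1) * α₀' ≤ 1 / 3) (hα4 : 4 * α₀' ≤ c2' (θ.d₆ + 1) (θ.ℓ₆ + 1))
    (hexp : Real.exp (4 * (800 * (((θ.d₆ + 1 : ℕ) : ℝ) + 1) ^ 2 * (((θ.d₆ + 1 : ℕ) : ℝ) + 4)) * α₀') < 2)
    (hKa : Kpl x.toKIdx a * (kGeo x.toKIdx).L ^ 4 < α₀') :
    ∀ α₀ : ℝ, 0 < α₀ → (geo9Y x).M * α₀ ≤ a → ∀ U : CfgY (Matrix (Fin N) (Fin N) ℂ) x.toKIdx,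
      (bg9YP (Matrix (Fin N) (Fin N) ℂ) (specialUnitaryUnits (Fin N)) x).Reg335 c₀ α₀ U → IsSymmTr (fun _ => (1 : ℝ)) ((resYOfRecordPK N θ Mstar x).Δ2 U) :=
  fun _ hα₀ hMa _ hreg =>
    resYOfRecordPK_Δ2_isSymmTr_SU_of_regQY N θ Mstar hc x (kGeo_M_mul_nonneg x.toKIdx hα₀.le) hα' hα3 hα4 hexp
      (Kpl_mul_L4_lt_of_thresh x.toKIdx hKa hα₀.le hMa) (regQY_of_reg335YP x hreg)

/-- ★★★ **THE CERTIFICATE's `hsymD` AT `𝔯 := resYOfRecordPK`** (general `G ≤ U(N)`): the v11 knit record's `G̃ ∧ G₁ ∧ 𝔊` over the knit residual of record are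
symmetric at every background of `regQY G x c₀ α₀` under the x-free numerics — `OpsYRecordV11Reg335.lettersYOfRecordV11K_symmDG₁GG_of_regQY` with its `hΔ2`
DISCHARGED by `resYOfRecordPK_Δ2_isSymmTr_of_regQY`. [cite: Balaban1985BackgroundPropagators, (3.122) p.420, (3.128) p.421, (3.134) p.422, (3.153) p.426, (3.35) p.396] [cite: Balaban1985Averaging, Prop. 2 p.26, (15) p.19] -/
theorem lettersYOfRecordV11K_symmDG₁GG_PK_of_regQY (hGU : G ≤ B7Prop2Explicit.unitaryUnits (Matrix (Fin N) (Fin N) ℂ)) {c₀ α₀ : ℝ} (hc : c₀ ≤ 10)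
    (x : MemberY θ.d₆ θ.ℓ₆ θ.hd' θ.hL' θ.b₀ θ.b₁ Mstar) (hMα : 0 ≤ (kGeo x.toKIdx).M * α₀) {α₀' : ℝ} (hα' : 0 < α₀')
    (hα3 : C0 (θ.d₆ + 1) * α₀' ≤ 1 / 3) (hα4 : 4 * α₀' ≤ c2' (θ.d₆ + 1) (θ.ℓ₆ + 1))
    (hexp : Real.exp (4 * (800 * (((θ.d₆ + 1 : ℕ) : ℝ) + 1) ^ 2 * (((θ.d₆ + 1 : ℕ) : ℝ) + 4)) * α₀') < 2)
    (hK : Kpl x.toKIdx ((kGeo x.toKIdx).M * α₀) * (kGeo x.toKIdx).L ^ 4 < α₀') {U : CfgY (Matrix (Fin N) (Fin N) ℂ) x.toKIdx}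
    (hU : regQY G x.toKIdx c₀ α₀ U) :
    IsSymmTr (fun _ => (1 : ℝ)) ((lettersYOfRecordV11K N θ Mstar (resYOfRecordPK N θ Mstar) x).GD U) ∧
      IsSymmTr (fun _ => (1 : ℝ)) ((lettersYOfRecordV11K N θ Mstar (resYOfRecordPK N θ Mstar) x).G₁ U) ∧
        IsSymmTr (fun _ => (1 : ℝ)) ((lettersYOfRecordV11K N θ Mstar (resYOfRecordPK N θ Mstar) x).GG U) :=
  lettersYOfRecordV11K_symmDG₁GG_of_regQY N θ Mstar (resYOfRecordPK N θ Mstar) (unitBddY_of_le_unitaryUnits hGU) hGU hc x hMα hα' hα3 (by linarith) hK hU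
    (resYOfRecordPK_Δ2_isSymmTr_of_regQY N θ Mstar hGU hc x hMα hα' hα3 hα4 hexp hK hU)

/-- ★★★ the same at `G := SU(N)`. [cite: Balaban1985BackgroundPropagators, (3.122) p.420, (3.128) p.421, (3.134) p.422, (3.153) p.426, (3.35) p.396, pp.389–390 (G ⊂ U(N))] [cite: Balaban1985Averaging, Prop. 2 p.26] -/
theorem lettersYOfRecordV11K_symmDG₁GG_PK_SU_of_regQY {c₀ α₀ : ℝ} (hc : c₀ ≤ 10) (x : MemberY θ.d₆ θ.ℓ₆ θ.hd' θ.hL' θ.b₀ θ.b₁ Mstar)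
    (hMα : 0 ≤ (kGeo x.toKIdx).M * α₀) {α₀' : ℝ} (hα' : 0 < α₀') (hα3 : C0 (θ.d₆ + 1) * α₀' ≤ 1 / 3) (hα4 : 4 * α₀' ≤ c2' (θ.d₆ + 1) (θ.ℓ₆ + 1))
    (hexp : Real.exp (4 * (800 * (((θ.d₆ + 1 : ℕ) : ℝ) + 1) ^ 2 * (((θ.d₆ + 1 : ℕ) : ℝ) + 4)) * α₀') < 2)
    (hK : Kpl x.toKIdx ((kGeo x.toKIdx).M * α₀) * (kGeo x.toKIdx).L ^ 4 < α₀') {U : CfgY (Matrix (Fin N) (Fin N) ℂ) x.toKIdx}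
    (hU : regQY (specialUnitaryUnits (Fin N)) x.toKIdx c₀ α₀ U) :
    IsSymmTr (fun _ => (1 : ℝ)) ((lettersYOfRecordV11K N θ Mstar (resYOfRecordPK N θ Mstar) x).GD U) ∧
      IsSymmTr (fun _ => (1 : ℝ)) ((lettersYOfRecordV11K N θ Mstar (resYOfRecordPK N θ Mstar) x).G₁ U) ∧
        IsSymmTr (fun _ => (1 : ℝ)) ((lettersYOfRecordV11K N θ Mstar (resYOfRecordPK N θ Mstar) x).GG U) :=
  lettersYOfRecordV11K_symmDG₁GG_PK_of_regQY N θ Mstar specialUnitaryUnits_le_unitaryUnits hc x hMα hα' hα3 hα4 hexp hK hU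

/-- ★★★ **dag-n06-d's `hsymD` AT `𝔯 := resYOfRecordPK`, threshold numerics folded** (member-law shape over `bg9YP … SU(N)`; `hKa : K_pl(a)·L⁴ < α₀′` at
`x.toKIdx` as in `OpsYRecordV11Thresh`). [cite: Balaban1985BackgroundPropagators, (3.122) p.420, (3.128) p.421, (3.134) p.422, (3.153) p.426, (3.35) p.396] [cite: Balaban1985Averaging, Prop. 2 p.26, (15) p.19] -/
theorem lettersYOfRecordV11K_symmDG₁GG_PK_SU_threshK (x : MemberY θ.d₆ θ.ℓ₆ θ.hd' θ.hL' θ.b₀ θ.b₁ Mstar) {c₀ : ℝ} (hc : c₀ ≤ 10) {a α₀' : ℝ}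
    (hα' : 0 < α₀') (hα3 : C0 (θ.d₆ + 1) * α₀' ≤ 1 / 3) (hα4 : 4 * α₀' ≤ c2' (θ.d₆ + 1) (θ.ℓ₆ + 1))
    (hexp : Real.exp (4 * (800 * (((θ.d₆ + 1 : ℕ) : ℝ) + 1) ^ 2 * (((θ.d₆ + 1 : ℕ) : ℝ) + 4)) * α₀') < 2)
    (hKa : Kpl x.toKIdx a * (kGeo x.toKIdx).L ^ 4 < α₀') :
    ∀ α₀ : ℝ, 0 < α₀ → (geo9Y x).M * α₀ ≤ a → ∀ U : CfgY (Matrix (Fin N) (Fin N) ℂ) x.toKIdx,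
      (bg9YP (Matrix (Fin N) (Fin N) ℂ) (specialUnitaryUnits (Fin N)) x).Reg335 c₀ α₀ U →
        IsSymmTr (fun _ => (1 : ℝ)) ((lettersYOfRecordV11K N θ Mstar (resYOfRecordPK N θ Mstar) x).GD U) ∧
          IsSymmTr (fun _ => (1 : ℝ)) ((lettersYOfRecordV11K N θ Mstar (resYOfRecordPK N θ Mstar) x).G₁ U) ∧
            IsSymmTr (fun _ => (1 : ℝ)) ((lettersYOfRecordV11K N θ Mstar (resYOfRecordPK N θ Mstar) x).GG U) :=
  fun _ hα₀ hMa _ hreg =>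
    lettersYOfRecordV11K_symmDG₁GG_PK_SU_of_regQY N θ Mstar hc x (kGeo_M_mul_nonneg x.toKIdx hα₀.le) hα' hα3 hα4 hexp
      (Kpl_mul_L4_lt_of_thresh x.toKIdx hKa hα₀.le hMa) (regQY_of_reg335YP x hreg)

/-- ★★★ the knit certificate's unit `(Q G₁ Q†)(U)` row from (3.138) at `𝔯 := resYOfRecordPK`, threshold numerics folded
(`OpsYRecordV11Reg335.lettersYOfRecordV11K_isUnit_QGQOfQY_G₁_of_regQY` at `G := SU(N)`).
[cite: Balaban1985BackgroundPropagators, (3.132) p.422, (3.138) p.423, p.420 («ω = (QGQ*)⁻¹B»), (3.35) p.396] [cite: Balaban1985Averaging, (139)–(147) pp.39–40] -/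
theorem lettersYOfRecordV11K_isUnit_QGQOfQY_G₁_PK_SU_threshK (x : MemberY θ.d₆ θ.ℓ₆ θ.hd' θ.hL' θ.b₀ θ.b₁ Mstar) {c₀ : ℝ} (hc : c₀ ≤ 10) {a α₀' : ℝ}
    (hα' : 0 < α₀') (hαQ : α₀' ≤ alphaQ (θ.d₆ + 1) (θ.ℓ₆ + 1)) (hKa : Kpl x.toKIdx a * (kGeo x.toKIdx).L ^ 4 < α₀')
    (hsmall : kCol (θ.d₆ + 1) (θ.ℓ₆ + 1) * α₀' < 1) :
    ∀ α₀ : ℝ, 0 < α₀ → (geo9Y x).M * α₀ ≤ a → ∀ U : CfgY (Matrix (Fin N) (Fin N) ℂ) x.toKIdx,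
      (bg9YP (Matrix (Fin N) (Fin N) ℂ) (specialUnitaryUnits (Fin N)) x).Reg335 c₀ α₀ U →
        PosDefTr (fun _ => (1 : ℝ)) (deltaOneQY x.toKIdx (qKnitOfRecord N θ x.toKIdx) (qsKnitOfRecord N θ x.toKIdx) (parKnitY x.toKIdx)
          (GpPhysY x.toKIdx (parKnitY x.toKIdx)) (resYOfRecordPK N θ Mstar x).Δ2 U) →
        IsUnit (QGQOfQY x.toKIdx (qKnitOfRecord N θ x.toKIdx) (qsKnitOfRecord N θ x.toKIdx)
          (lettersYOfRecordV11K N θ Mstar (resYOfRecordPK N θ Mstar) x).G₁ U) :=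
  fun _ hα₀ hMa _ hreg hΔ1 =>
    lettersYOfRecordV11K_isUnit_QGQOfQY_G₁_of_regQY N θ Mstar (resYOfRecordPK N θ Mstar) unitBddY_specialUnitaryUnits
      specialUnitaryUnits_le_unitaryUnits hc x (kGeo_M_mul_nonneg x.toKIdx hα₀.le) hα' hαQ (Kpl_mul_L4_lt_of_thresh x.toKIdx hKa hα₀.le hMa) hsmall
      (regQY_of_reg335YP x hreg) hΔ1

end KnitRegimeRecord

end Literature.MathematicalPhysics.QuantumFieldTheory.Balaban1983to89.Node00

end
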